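import Literature.Probability.Percolation.HierarchicalSusceptibilityStep
import HarnessLib

/-!
# Hierarchical long-range percolation: the restricted susceptibility bound (Hutchcroft 2022, Prop. 2.7)

Topic `Literature/Probability/Percolation`. Theorem-only sequel of
`HierarchicalSusceptibilityStep.lean` (Lemma 2.8), toward the named fact
`Hutchcroft2022_twoPoint_volumeTail`: **`sumConn_lt_of_isGoodUpTo`** — Proposition 2.7 in
finite-height form: `Σ_{x,y ∈ B_n(x)} P(x ↔ y in η_{B_n(x)}) < (A/(cβ)) L^{(d+α)n}` for `0 < β < β_c`
whenever `B_k(x)` is a good child of `B_{k+1}(x)` for `n ≤ k < N`, `N ≥ N₀(β,σ)` (in particular for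
ancestrally good blocks). Runaway argument: Lemma 2.8 (with `τ = h^{-1/2}`, the sibling of larger
susceptibility, and Prop. 2.4 at the parent) against `Σ ≤ L^{dm} sup_x E_β|K(x)|` (sharpness).

## References

* [Hutchcroft2022] T. Hutchcroft, J. Math. Phys. 63 (2022), arXiv:2202.07634, Proposition 2.7 and
  its proof (pp. 11–12).
-/

noncomputable section

namespace Literature.Probability.Percolation

open Finset MeasureTheory Literature.Probability.LatticeModels

variable {d : ℕ}

/-! ### Proposition 2.7 -/

section Prop27

open MeasureTheory

variable {L : ℕ} {o : ℕ → Site d} {J : Sym2 (Site d) → ℝ} {c α β : ℝ}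

/-- A good child has a sibling with at least its susceptibility ((2.9)). [cite: Hutchcroft2022, §2.2 (2.9)] -/
theorem IsGood.exists_sibling_sumConn_le {n : ℕ} {x : Site d} {B : Finset (Site d)}
    (h : IsGood J L o c α β n x B) :
    ∃ B' ∈ children L o n x, B' ≠ B ∧ sumConn J L o c α β B ≤ sumConn J L o c α β B' := by
  classical
  obtain ⟨-, -, h3⟩ := h
  obtain ⟨B', hB'⟩ := Finset.card_pos.1 (lt_of_lt_of_le zero_lt_one h3)
  obtain ⟨hC, hne, hle⟩ := Finset.mem_filter.1 hB'
  exact ⟨B', hC, hne, hle⟩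

/-- The coupling scale: `h = cβL^{-(d+α)(m+1)} = cβ / L^{(d+α)(m+1)}`. [cite: Hutchcroft2022, proof of Lemma 2.8 ("Write h = cβL^{-(d+α)(n+1)}")] -/
theorem hScale_eq (hL : 1 ≤ L) (m : ℕ) (β c α : ℝ) :
    β * (c * ((L : ℝ) ^ (m + 1)) ^ (-((d : ℝ) + α))) =
      c * β / (L : ℝ) ^ (((d : ℝ) + α) * ((m : ℝ) + 1)) := by
  have hℓ : (0 : ℝ) < L := by exact_mod_cast (by omega : 0 < L)
  rw [← Real.rpow_natCast (L : ℝ) (m + 1), ← Real.rpow_mul hℓ.le,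
    show ((m + 1 : ℕ) : ℝ) * -((d : ℝ) + α) = -(((d : ℝ) + α) * ((m : ℝ) + 1)) by push_cast; ring,
    Real.rpow_neg hℓ.le]
  ring

/-- **Proposition 2.7** (upper bound on the restricted susceptibility), finite-height form: there
is `L₀ = L₀(d,α) ≥ 2` and, for `L ≥ L₀`, `A = A(d,L,α) > 0` such that for every `0 < β < β_c` and
offsets `σ` there is a height `N₀` with `Σ_{x,y ∈ B_n(x)} P(x ↔ y in η_{B_n(x)}) < (A/(cβ)) L^{(d+α)n}`
whenever `B_k(x)` is a good child of `B_{k+1}(x)` for all `n ≤ k < N`, `N ≥ N₀` (in particular for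
ancestrally good blocks, the printed statement). Proof as printed: otherwise Lemma 2.8 (with the
sibling of larger susceptibility, `τ = h^{-1/2}` and Prop. 2.4 to bound `M_B, M_{B'} ≤ M_{σ(B)}`)
iterates to `Σ ≥ (A/(cβ))L^{(d+α)m}` up the ancestral line, contradicting
`Σ_{x,y∈B_m} P(x ↔ y in η_{B_m}) ≤ L^{dm} sup_x E_β|K(x)| < ∞` (sharpness) for large `m`.
[cite: Hutchcroft2022, Proposition 2.7 and its proof (pp. 11–12)] -/
theorem sumConn_lt_of_isGoodUpTo (hd : 1 ≤ d) (hα0 : 0 < α) (hαd : α < d) :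
    ∃ L₀ : ℕ, 2 ≤ L₀ ∧ ∀ L : ℕ, L₀ ≤ L → ∃ A : ℝ, 0 < A ∧
      ∀ (o : ℕ → Site d), IsHierOffset L o → ∀ (J : Sym2 (Site d) → ℝ) (c β : ℝ), 0 < c → 0 < β →
        β < kernelCriticalBeta J → (∀ e, 0 ≤ J e) → IsTranslationInvariantKernel J →
        IsIntegrableKernel J → HasPowerLowerBound J c α →
        ∃ N₀ : ℕ, ∀ (n N : ℕ) (x : Site d), N₀ ≤ N → IsGoodUpTo J L o c α β n N x →
          sumConn J L o c α β (block L o n x) < A / (c * β) * (L : ℝ) ^ (((d : ℝ) + α) * n) := by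
  have hα : 0 ≤ (d : ℝ) + α := by positivity
  obtain ⟨L₀, hL₀2, hP24⟩ := Mblock_sq_lt_of_isGoodUpTo (d := d) hd hα0 hαd
  refine ⟨L₀, hL₀2, fun L hLL => ?_⟩
  obtain ⟨A₄, hA₄, hM⟩ := hP24 L hLL
  have hL : 2 ≤ L := le_trans hL₀2 hLL
  have hL1 : 1 ≤ L := le_trans (by norm_num) hL
  have hℓ : (0 : ℝ) < L := by exact_mod_cast (by omega : 0 < L)
  -- constants
  set κ₀ : ℝ := min 1 (1 / (10 * Real.sqrt A₄)) with hκ₀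
  have hκ₀pos : 0 < κ₀ := lt_min zero_lt_one (by positivity)
  set a : ℝ := (1 - Real.exp (-1)) / 4 * κ₀ ^ 2 with ha
  have he1 : 0 < 1 - Real.exp (-1) := by
    have : Real.exp (-1) < 1 := Real.exp_lt_one_iff.2 (by norm_num)
    linarith
  have hapos : 0 < a := by positivity
  set Λ₁ : ℝ := (L : ℝ) ^ ((d : ℝ) + α) with hΛ₁
  have hΛ₁pos : 0 < Λ₁ := Real.rpow_pos_of_pos hℓ _
  set A : ℝ := Λ₁ ^ 2 / a with hA
  have hApos : 0 < A := by positivity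
  refine ⟨A, hApos, ?_⟩
  intro o ho J c β hc hβ hβc hJ0 hT hI hJ
  obtain ⟨N₄, hN₄⟩ := hM o ho J c β hc hβ hβc hJ0 hT hI hJ
  obtain ⟨C, hC⟩ := exists_sum_real_openConn_le_of_lt_criticalBeta hJ0 hT hI hβ.le hβc
  have hcβ : 0 < c * β := mul_pos hc hβ
  -- the a-priori bound `S(B_m(x)) ≤ C L^{dm}`
  have hbound : ∀ (m : ℕ) (x : Site d), sumConn J L o c α β (block L o m x) ≤ C * (L : ℝ) ^ (d * m) := by
    intro m x
    unfold sumConn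
    calc ∑ u ∈ block L o m x, ∑ v ∈ block L o m x, (etaLaw J L o c α β (block L o m x)).real (openConn u v)
        ≤ ∑ u ∈ block L o m x, ∑ v ∈ block L o m x, (kernelPercolation J β).real (openConn u v) :=
          Finset.sum_le_sum fun u _ => Finset.sum_le_sum fun v _ =>
            etaLaw_real_openConn_le hL ho hc.le hα hJ0 hJ hβ.le _ u v
      _ ≤ ∑ _u ∈ block L o m x, C := Finset.sum_le_sum fun u _ => hC _ u
      _ = C * (L : ℝ) ^ (d * m) := by
          rw [Finset.sum_const, nsmul_eq_mul, card_block o m x]; push_cast; rw [← pow_mul', mul_comm]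
  -- from `(A/(cβ)) L^{(d+α)m} ≤ S(B_m)` we get `(L^α)^m ≤ K := C cβ / A`
  have hK : ∀ (m : ℕ) (x : Site d), A / (c * β) * (L : ℝ) ^ (((d : ℝ) + α) * m) ≤
      sumConn J L o c α β (block L o m x) → ((L : ℝ) ^ α) ^ m ≤ C * (c * β) / A := by
    intro m x hm
    have h1 := hm.trans (hbound m x)
    have hsplit : (L : ℝ) ^ (((d : ℝ) + α) * (m : ℝ)) = (L : ℝ) ^ (d * m) * ((L : ℝ) ^ α) ^ m := by
      have e1 : ((d : ℝ) + α) * (m : ℝ) = ((d * m : ℕ) : ℝ) + α * (m : ℝ) := by push_cast; ring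
      rw [e1, Real.rpow_add hℓ, Real.rpow_natCast, Real.rpow_mul hℓ.le, Real.rpow_natCast]
    rw [hsplit] at h1
    have hpos : 0 < (L : ℝ) ^ (d * m) := pow_pos hℓ _
    have h2 : A / (c * β) * ((L : ℝ) ^ α) ^ m ≤ C := by
      have h1' : (A / (c * β) * ((L : ℝ) ^ α) ^ m) * (L : ℝ) ^ (d * m) ≤ C * (L : ℝ) ^ (d * m) :=
        calc _ = A / (c * β) * ((L : ℝ) ^ (d * m) * ((L : ℝ) ^ α) ^ m) := by ring
          _ ≤ _ := h1
      exact le_of_mul_le_mul_right h1' hpos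
    have h3 : A * ((L : ℝ) ^ α) ^ m ≤ C * (c * β) := by
      have := mul_le_mul_of_nonneg_right h2 hcβ.le
      calc A * ((L : ℝ) ^ α) ^ m = A / (c * β) * ((L : ℝ) ^ α) ^ m * (c * β) := by field_simp
        _ ≤ _ := this
    rw [le_div_iff₀ hApos, mul_comm]
    exact h3
  have hLα : 1 < (L : ℝ) ^ α := Real.one_lt_rpow (by exact_mod_cast hL) hα0
  obtain ⟨j, hj⟩ := pow_unbounded_of_one_lt (C * (c * β) / A) hLα
  refine ⟨max N₄ j, fun n N x hN hgood => ?_⟩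
  have hN₄N : N₄ ≤ N := le_trans (le_max_left _ _) hN
  have hjN : j ≤ N := le_trans (le_max_right _ _) hN
  by_contra hnot
  push Not at hnot
  -- one step of Lemma 2.8 along the good part of the ancestral line
  have hstep : ∀ m : ℕ, n ≤ m → m < N →
      A / (c * β) * (L : ℝ) ^ (((d : ℝ) + α) * m) ≤ sumConn J L o c α β (block L o m x) →
      A / (c * β) * (L : ℝ) ^ (((d : ℝ) + α) * ((m : ℝ) + 1)) ≤ sumConn J L o c α β (block L o (m + 1) x) := by
    intro m hnm hmN hSm
    have hgm : IsGood J L o c α β m x (block L o m x) := hgood m hnm hmN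
    have hBm : block L o m x ∈ children L o m x := hgm.1
    obtain ⟨B', hB'C, hB'ne, hSle⟩ := hgm.exists_sibling_sumConn_le
    -- the scale `h` and `τ = h^{-1/2}`
    set hh : ℝ := β * (c * ((L : ℝ) ^ (m + 1)) ^ (-((d : ℝ) + α))) with hhh
    have hE : hh = c * β / (L : ℝ) ^ (((d : ℝ) + α) * ((m : ℝ) + 1)) := hScale_eq hL1 m β c α
    have hEpos : 0 < (L : ℝ) ^ (((d : ℝ) + α) * ((m : ℝ) + 1)) := Real.rpow_pos_of_pos hℓ _
    have hhpos : 0 < hh := by rw [hE]; positivity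
    set τ : ℝ := 1 / Real.sqrt hh with hτ
    have hτpos : 0 < τ := by rw [hτ]; positivity
    have hτsq : τ ^ 2 = 1 / hh := by
      rw [hτ, div_pow, one_pow, Real.sq_sqrt hhpos.le]
    have hτh : hh * τ ^ 2 ≤ 1 := by rw [hτsq, mul_one_div_cancel hhpos.ne']
    -- Prop 2.4 at the parent
    have hMP := hN₄ (m + 1) N x hN₄N (hgood.mono (by omega) le_rfl)
    -- `M_{σ(B)}² < A₄ τ²`
    have hMP' : (Mblock J L o c α β (block L o (m + 1) x) : ℝ) ^ 2 < A₄ * τ ^ 2 := by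
      rw [hτsq, hE]
      convert hMP using 1
      push_cast
      field_simp
    have hMPlt : (Mblock J L o c α β (block L o (m + 1) x) : ℝ) < Real.sqrt A₄ * τ := by
      have h0 : (0 : ℝ) ≤ Mblock J L o c α β (block L o (m + 1) x) := Nat.cast_nonneg _
      rw [← Real.sqrt_sq h0, ← Real.sqrt_sq hτpos.le, ← Real.sqrt_mul hA₄.le]
      exact Real.sqrt_lt_sqrt (sq_nonneg _) hMP'
    -- `κ₀ ≤ κ_B, κ_{B'}`
    have hκ : ∀ B₀ : Finset (Site d), B₀ ∈ children L o m x →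
        κ₀ ≤ min 1 (τ / (10 * (Mblock J L o c α β B₀ : ℝ))) := by
      intro B₀ hB₀
      have hle : (Mblock J L o c α β B₀ : ℝ) ≤ Mblock J L o c α β (block L o (m + 1) x) := by
        exact_mod_cast Mblock_le_parent hL hd ho hB₀
      have hM2 : (2 : ℝ) ≤ Mblock J L o c α β B₀ := by
        unfold Mblock; exact_mod_cast two_le_typicalMax _ (nonempty_of_mem_children hL1 hB₀)
      refine min_le_min_left 1 ?_
      -- `1/(10 √A₄) ≤ τ/(10 M_{B₀})` since `M_{B₀} ≤ M_P < √A₄ τ`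
      rw [div_le_div_iff₀ (by positivity) (by positivity)]
      nlinarith [hle, hMPlt, hτpos]
    have h28 := sumConn_parent_ge hL hd ho hc.le hα hJ0 hJ hβ.le hBm hB'C hB'ne.symm hτpos hτh
    -- lower bounds of the factors
    have hS0 : 0 ≤ sumConn J L o c α β (block L o m x) := sumConn_nonneg _
    have hSm0 : 0 ≤ A / (c * β) * (L : ℝ) ^ (((d : ℝ) + α) * m) := by positivity
    have hprod : κ₀ ^ 2 ≤ min 1 (τ / (10 * (Mblock J L o c α β (block L o m x) : ℝ))) *
        min 1 (τ / (10 * (Mblock J L o c α β B' : ℝ))) := by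
      rw [sq]; exact mul_le_mul (hκ _ hBm) (hκ _ hB'C) hκ₀pos.le (le_trans hκ₀pos.le (hκ _ hBm))
    have hSS : (A / (c * β) * (L : ℝ) ^ (((d : ℝ) + α) * m)) ^ 2 ≤
        sumConn J L o c α β (block L o m x) * sumConn J L o c α β B' := by
      rw [sq]; exact mul_le_mul hSm (hSm.trans hSle) hSm0 hS0
    -- the algebra: `a h (A/(cβ))² L^{2(d+α)m} = (A/(cβ)) L^{(d+α)(m+1)}`
    have halg : a * hh * (A / (c * β) * (L : ℝ) ^ (((d : ℝ) + α) * m)) ^ 2 =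
        A / (c * β) * (L : ℝ) ^ (((d : ℝ) + α) * ((m : ℝ) + 1)) := by
      have hEm : (L : ℝ) ^ (((d : ℝ) + α) * ((m : ℝ) + 1)) = (L : ℝ) ^ (((d : ℝ) + α) * m) * Λ₁ := by
        rw [hΛ₁, ← Real.rpow_add hℓ]; congr 1; ring
      rw [hE, hEm, hA]
      field_simp
    calc A / (c * β) * (L : ℝ) ^ (((d : ℝ) + α) * ((m : ℝ) + 1))
        = a * hh * (A / (c * β) * (L : ℝ) ^ (((d : ℝ) + α) * m)) ^ 2 := halg.symm
      _ = (1 - Real.exp (-1)) / 4 * hh * κ₀ ^ 2 * (A / (c * β) * (L : ℝ) ^ (((d : ℝ) + α) * m)) ^ 2 := by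
          rw [ha]; ring
      _ ≤ (1 - Real.exp (-1)) / 4 * hh *
            (min 1 (τ / (10 * (Mblock J L o c α β (block L o m x) : ℝ))) *
              min 1 (τ / (10 * (Mblock J L o c α β B' : ℝ)))) *
            (sumConn J L o c α β (block L o m x) * sumConn J L o c α β B') := by
          apply mul_le_mul (mul_le_mul_of_nonneg_left hprod (by positivity)) hSS (sq_nonneg _)
          exact mul_nonneg (by positivity) (le_trans (sq_nonneg _) hprod)
      _ ≤ sumConn J L o c α β (block L o (m + 1) x) := h28
  -- climb from `n` to `max n N`
  have hclimb : ∀ k : ℕ, n + k ≤ max n N →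
      A / (c * β) * (L : ℝ) ^ (((d : ℝ) + α) * ((n + k : ℕ) : ℝ)) ≤ sumConn J L o c α β (block L o (n + k) x) := by
    intro k
    induction k with
    | zero => intro _; simpa using hnot
    | succ k ih =>
      intro hk
      have := hstep (n + k) (by omega) (by omega) (by exact_mod_cast ih (by omega))
      rw [show n + (k + 1) = n + k + 1 from (Nat.add_assoc n k 1).symm]
      convert this using 3
      push_cast; ring
  have htop := hclimb (max n N - n) (by omega)
  rw [show n + (max n N - n) = max n N by omega] at htop
  have h1 := hK (max n N) x htop
  have h2 : ((L : ℝ) ^ α) ^ j ≤ ((L : ℝ) ^ α) ^ (max n N) :=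
    pow_le_pow_right₀ hLα.le (le_trans hjN (le_max_right _ _))
  linarith

end Prop27


end Literature.Probability.Percolation

end
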